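import Mathlib.Data.Matrix.Basic
import Mathlib.Algebra.BigOperators.Group.Finset.Basic

/-!
# T-TEL (telescoping identity) line, helper 5 — ALL SCALES AT MATRIX LEVEL: the one-step transport recursion, unrolled, IS the telescoping sum
# (the one-shot `m`-fold jet = the sum over `j < m` of the step jets transported by the COMPOSITE responses)

Helper for crux K2⁷ `EndpointGivenBR13SepCoPH` = stmt-QuantumFields-20543 (route `BalabanUVNodes`), seat `d1-tel-1` gen 0 (director-ym R576-ym (D)(2): «T-TEL … for all
L ≥ 2 and all scales j»).  Helpers 1–4 (`…SchurQuotient` p782298, `…SchurJets` p782375, `…SchurJetsCurves` p782412, `…SchurSymmetric`) give ONE step in closed form: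
the jets of the one-step effective form are the dressings `Gᵀ·M·G` of the full form's jets by the response graph, plus the step's own (bubble) term.  This file does
the bookkeeping over ALL SCALES in exactly the shape of the tree's kernel predicate `HessianTelescopingKKT.StepRecursion`
(`𝒯 (j+1) = (w j)ᵀ · 𝒯 j · (w j) + T j`, one-shot ∕ step families on a TOWER of levels with their own finite index types `Λ j`) and of its conclusion
`HidentScalewise.HessianTelescoping` (one-shot = SUM over `j < m` of transported step data): `oneShot_eq_sum_transported` — by induction on `m`, nothing else.
[folklore]; 0 `def`, 0 `sorry`; Mathlib-only.  The composite responses enter as a two-index family `P j m : Λ j × Λ m` with its recursion DISPLAYED as hypotheses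
(`P m m = 1`, `P j (m+1) = P j m · w m`), so no definition is introduced.

HONEST FRAMING.  Finite-dimensional bookkeeping; nothing of Bałaban's kernels asserted; the kernel-level dictionary (S3) of
`Cruxes/EndpointGivenBR13SepCoPH/D1TelSignatures.lean` is OPEN (LAYER 2, road «FP» route T); at kernel level the same unrolling is the tree's
`HessianTelescopingKKT.hessianTelescoping_of_stepRecursion` (second-moment tensors); `D1Tel`, K2⁷, `BetaPertH` NOT proved; NOT continuum, NOT OS, NOT Clay; the
Yang–Mills mass gap is NOT proved.
-/

namespace Summit.QuantumFields.YangMills.Theorems.BalabanUVNodesK2D1TelUnrolledRecursion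

open Matrix Finset

variable {𝕜 : Type*} [CommRing 𝕜]
variable {Λ : ℕ → Type*} [∀ j, Fintype (Λ j)] [∀ j, DecidableEq (Λ j)]

/-- [folklore] **THE ONE-STEP TRANSPORT RECURSION, UNROLLED (all scales).**  Levels `Λ 0, Λ 1, …` (finite index types); one-step responses
`w j : Λ j × Λ (j+1)` (level-`(j+1)` background ↦ level-`j` response); STEP data `T j` on level `j+1`; ONE-SHOT data `𝒯 m` on level `m` with `𝒯 0 = 0` and the
recursion `𝒯 (m+1) = (w m)ᵀ·𝒯 m·(w m) + T m` (the matrix shape of `HessianTelescopingKKT.StepRecursion`, base folded in as `𝒯 1 = T 0`); COMPOSITE responses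
`P j m : Λ j × Λ m` with `P m m = 1`, `P j (m+1) = P j m · w m`.  THEN for every `m`:
`𝒯 m = Σ_{j<m} (P (j+1) m)ᵀ · T j · P (j+1) m` — the one-shot `m`-fold datum is the SUM of the step data transported by the composite responses
(the matrix shape of `HidentScalewise.HessianTelescoping`). -/
theorem oneShot_eq_sum_transported (w : ∀ j : ℕ, Matrix (Λ j) (Λ (j + 1)) 𝕜) (T : ∀ j : ℕ, Matrix (Λ (j + 1)) (Λ (j + 1)) 𝕜)
    (𝒯 : ∀ m : ℕ, Matrix (Λ m) (Λ m) 𝕜) (P : ∀ j m : ℕ, Matrix (Λ j) (Λ m) 𝕜)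
    (hP0 : ∀ m, P m m = 1) (hPs : ∀ j m, P j (m + 1) = P j m * w m)
    (h0 : 𝒯 0 = 0) (hrec : ∀ m, 𝒯 (m + 1) = (w m)ᵀ * 𝒯 m * w m + T m) :
    ∀ m : ℕ, 𝒯 m = ∑ j ∈ range m, (P (j + 1) m)ᵀ * T j * P (j + 1) m := by
  intro m
  induction m with
  | zero => rw [h0, sum_range_zero]
  | succ m ih =>
    rw [hrec m, ih, sum_range_succ, hP0 (m + 1), transpose_one, Matrix.one_mul, Matrix.mul_one, Matrix.mul_sum, Matrix.sum_mul]
    congr 1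
    refine sum_congr rfl fun j _ => ?_
    rw [hPs (j + 1) m, transpose_mul]
    simp only [Matrix.mul_assoc]

/-- [folklore] **READ-OUT FORM**: for any family of ADDITIVE read-outs `F m : Matrix (Λ m) (Λ m) 𝕜 →+ R` (e.g. a second-moment tensor ∕ the `(μ,ν)` coefficient),
the one-shot read-out is the sum of the read-outs of the transported step data — the shape of (D1) ∕ `HidentScalewise.hident_trivial_of_scalewise`. -/
theorem readout_oneShot_eq_sum {R : Type*} [AddCommMonoid R] (w : ∀ j : ℕ, Matrix (Λ j) (Λ (j + 1)) 𝕜)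
    (T : ∀ j : ℕ, Matrix (Λ (j + 1)) (Λ (j + 1)) 𝕜) (𝒯 : ∀ m : ℕ, Matrix (Λ m) (Λ m) 𝕜) (P : ∀ j m : ℕ, Matrix (Λ j) (Λ m) 𝕜)
    (hP0 : ∀ m, P m m = 1) (hPs : ∀ j m, P j (m + 1) = P j m * w m)
    (h0 : 𝒯 0 = 0) (hrec : ∀ m, 𝒯 (m + 1) = (w m)ᵀ * 𝒯 m * w m + T m) (F : ∀ m : ℕ, Matrix (Λ m) (Λ m) 𝕜 →+ R) (m : ℕ) :
    F m (𝒯 m) = ∑ j ∈ range m, F m ((P (j + 1) m)ᵀ * T j * P (j + 1) m) := by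
  rw [oneShot_eq_sum_transported w T 𝒯 P hP0 hPs h0 hrec m, map_sum]

end Summit.QuantumFields.YangMills.Theorems.BalabanUVNodesK2D1TelUnrolledRecursion
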